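import Literature.Analysis.FluidPDE.PassiveVectorGalerkinSolution
import Summits.AnomalousDissipation.AnomalousDissipation.Theorems.SolenoidalFractalHomogenisationRealisedQuasiStaticCellLawCellUnique
import Summits.AnomalousDissipation.AnomalousDissipation.Theorems.SolenoidalFractalHomogenisationRealisedQuasiStaticCellLawSectorPieces
import HarnessLib

/-!
# K2R `RealisedQuasiStaticCellLaw`, line `floquet-bloch`: the registered stub `stub_sectorExists`
# (a weak `A = 0` solution in one Bloch sector around the cells of any lattice word, with the sector-Poincaré decay)

Summits-side stub proof (everything proved; no definitions, no named facts; `--supports stmt-AnomalousDissipation-20446`,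
registered stub `stub_sectorExists` of skeleton r15 (sha16 e034a937924b185d), BY NAME and verbatim signature).

For ANY lattice word `W'`, cell number `n ≥ 1`, viscosity `κ > 0`, a Bloch sector `{k ≡ ±ℓ (mod n)}` and `R` with
`R² ≤ |k|²` on the non-zero frequencies of the sector, every `H¹` weakly divergence-free mean-zero datum Fourier-supported in
the sector admits a weak solution of the passive solenoidal vector equation (`Torus.IsWeakPassiveVectorOn 0 T κ (W'.cell n)`)
which stays in the sector for a.e. `t ∈ (0,T)` and obeys `∫‖w t‖² ≤ e^{-8π²κR²t} ∫‖w₀‖²` for a.e. `t`.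

Proof. The cell carrier `(W'.cell n) t = (1/n) • B(t, n • ·)` is, at every time, a real divergence-free vector trigonometric
polynomial with frequencies in the finite symmetric set `{± n m_j}` (each Kolmogorov layer `(sin(2π n m·x + φ)/(2π|m|)) ê` is
the real part of two modes, `complexify_layer_nsmul_eq_trigPoly`), with coefficients bounded by `k₀/(2π)` and continuous in
time (joint continuity of the cell carrier): a `Torus.TrigPolyCarrier`. The Bloch sector is stable under translation by
`± n m_j`, and the datum hypotheses are those of `Torus.PVSetup`; the Literature theorem
`Torus.PVSetup.exists_weak_solution` (Fourier–Galerkin method: `PassiveVectorGalerkin*`, Robinson–Rodrigo–Sadowski 2016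
Thm. 4.4 transposed to the passive vector) delivers the solution with sector support and decay for every `t ≥ 0`.
-/

set_option linter.dupNamespace false

noncomputable section

namespace Summit.AnomalousDissipation.AnomalousDissipation.Theorems.SolenoidalFractalHomogenisation.RealisedQuasiStaticCellLaw

open Set MeasureTheory Filter Topology Function
open scoped InnerProductSpace
open Literature.Analysis Literature.Analysis.FunctionSpaces Literature.Analysis.FunctionSpaces.Torus
open Literature.Analysis.FluidPDE Literature.Analysis.FluidPDE.LatticeShear
open Summit.AnomalousDissipation.AnomalousDissipation.Theorems.SolenoidalFractalHomogenisation.PermissibleCarrier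

variable {k₀ : ℕ}

/-! ### One rescaled layer as a two-mode trigonometric polynomial -/

/-- `Im u / R` through `u` and `conj u`: `(Im u / R : ℂ) = u/(2RI) - conj u/(2RI)`. -/
private theorem ofReal_im_div_eq (u : ℂ) {R : ℝ} (hR : R ≠ 0) :
    ((u.im / R : ℝ) : ℂ) = u * (1 / (2 * (R : ℂ) * Complex.I)) + starRingEnd ℂ u * (-(1 / (2 * (R : ℂ) * Complex.I))) := by
  have hD : (2 * (R : ℂ) * Complex.I) ≠ 0 := by
    simp [hR, Complex.I_ne_zero]
  rw [mul_neg, ← sub_eq_add_neg, ← sub_mul, Complex.sub_conj]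
  push_cast
  field_simp

/-- **The rescaled Kolmogorov layer is a two-mode trigonometric polynomial**: with `K = n m` (componentwise `m i * n`),
`R = 2π|m|`, `a = e^{iφ}/(2RI)`, `a' = -e^{-iφ}/(2RI)`,
`complexify (layer (n • x)) = (e_K(x) a + e_{-K}(x) a') • complexify ê`. -/
theorem complexify_layer_nsmul (P : LatticePhase) (n : ℕ) (x : UnitAddTorus (Fin 3)) :
    EuclideanSpace.complexify (P.layer (n • x)) =
      (UnitAddTorus.mFourier (fun i => P.m i * n) x *
          (Complex.exp (P.φ * Complex.I) * (1 / (2 * ((2 * Real.pi * ‖latticeVec P.m‖ : ℝ) : ℂ) * Complex.I))) +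
        UnitAddTorus.mFourier (-fun i => P.m i * n) x *
          (starRingEnd ℂ (Complex.exp (P.φ * Complex.I)) *
            (-(1 / (2 * ((2 * Real.pi * ‖latticeVec P.m‖ : ℝ) : ℂ) * Complex.I))))) •
        EuclideanSpace.complexify P.e := by
  have hR : (2 * Real.pi * ‖latticeVec P.m‖) ≠ 0 := by
    have := one_le_norm_latticeVec P.m_ne
    positivity
  rw [layer_nsmul_eq, (EuclideanSpace.complexify (ι := Fin 3)).map_smul, ← Complex.coe_smul,
    ofReal_im_div_eq _ hR, UnitAddTorus.mFourier_neg, map_mul]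
  congr 1
  ring

/-- The two-mode coefficient family of the rescaled layer `j ↦` (frequencies `±K`, `K i = m i * n`). Stated through the
trigonometric polynomial on the pair `{K, -K}`: for `K ≠ -K`,
`complexify ∘ layer(n • ·) = trigPoly {K, -K} (k ↦ ((k = K ? a : 0) + (k = -K ? a' : 0)) • complexify ê)`. -/
theorem complexify_layer_nsmul_eq_trigPoly (P : LatticePhase) {n : ℕ} (hn : 0 < n) :
    (EuclideanSpace.complexify ∘ fun x : UnitAddTorus (Fin 3) => P.layer (n • x)) =
      Torus.trigPoly ({(fun i => P.m i * n), -(fun i => P.m i * n)} : Finset (Fin 3 → ℤ))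
        (fun k => ((if k = (fun i => P.m i * n) then
            Complex.exp (P.φ * Complex.I) * (1 / (2 * ((2 * Real.pi * ‖latticeVec P.m‖ : ℝ) : ℂ) * Complex.I)) else 0) +
          (if k = -(fun i => P.m i * n) then
            starRingEnd ℂ (Complex.exp (P.φ * Complex.I)) *
              (-(1 / (2 * ((2 * Real.pi * ‖latticeVec P.m‖ : ℝ) : ℂ) * Complex.I))) else 0)) •
          EuclideanSpace.complexify P.e) := by
  set K : Fin 3 → ℤ := fun i => P.m i * n with hK
  have hK0 : K ≠ 0 := by
    intro h
    apply P.m_ne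
    funext i
    have hi := congrFun h i
    simp only [hK, Pi.zero_apply, mul_eq_zero, Int.natCast_eq_zero] at hi
    rcases hi with hi | hi
    · exact hi
    · exact absurd hi hn.ne'
  have hKK : K ≠ -K := fun h => hK0 (by
    have : (2 : ℤ) • K = 0 := by rw [two_zsmul]; nth_rewrite 2 [h]; exact add_neg_cancel K
    exact (smul_eq_zero.1 this).resolve_left two_ne_zero)
  have hKK' : -K ≠ K := fun h => hKK h.symm
  funext x
  rw [Function.comp_apply, complexify_layer_nsmul, Torus.trigPoly_apply, Finset.sum_pair hKK]
  simp only [if_true, if_neg hKK, if_neg hKK', add_zero, zero_add, smul_smul, ← add_smul]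
  rfl

/-! ### The cell carrier as a trigonometric-polynomial carrier -/

/-- The cell slice as an envelope-weighted layer combination:
`(W.cell n) t x = Σⱼ ((1/n)·trap_j(t)) • layer_j(n • x)`. -/
theorem cell_eq_layerComb (W : LatticeWord k₀) (n : ℕ) (t : ℝ) :
    W.cell n t = fun x => ∑ j, ((1 / (n : ℝ)) *
      LatticeWord.trapezoid (W.start j) (W.phase j).τ W.ramp (Int.fract (t / W.period) * W.period)) •
        (W.phase j).layer (n • x) := by
  funext x
  simp only [LatticeWord.cell, carrier_nsmul_apply, Finset.smul_sum, smul_smul]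

/-- The cell slice is smooth. -/
theorem isSmooth_cell (W : LatticeWord k₀) (n : ℕ) (t : ℝ) : IsSmooth (W.cell n t) := by
  rw [cell_eq_layerComb]; exact isSmooth_layerComb W _ n

/-- The cell slice is (classically) divergence free. -/
theorem isDivFree_cell (W : LatticeWord k₀) (n : ℕ) (t : ℝ) : IsDivFree (W.cell n t) := by
  rw [cell_eq_layerComb]; exact isDivFree_layerComb W _ n

/-- **The complexified cell slice is a trigonometric polynomial** on the frequency set `⋃ⱼ {±K_j}`, `K_j i = m_j i * n`,
with the envelope-weighted two-mode coefficients. -/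
theorem complexify_comp_cell_eq_trigPoly (W : LatticeWord k₀) {n : ℕ} (hn : 0 < n) (t : ℝ) :
    (EuclideanSpace.complexify ∘ W.cell n t) =
      Torus.trigPoly (Finset.univ.biUnion fun j : Fin k₀ =>
          ({(fun i => (W.phase j).m i * n), -(fun i => (W.phase j).m i * n)} : Finset (Fin 3 → ℤ)))
        (fun k => ∑ j : Fin k₀, (((1 / (n : ℝ)) *
          LatticeWord.trapezoid (W.start j) (W.phase j).τ W.ramp (Int.fract (t / W.period) * W.period) : ℝ) : ℂ) •
          (((if k = (fun i => (W.phase j).m i * n) then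
              Complex.exp ((W.phase j).φ * Complex.I) *
                (1 / (2 * ((2 * Real.pi * ‖latticeVec (W.phase j).m‖ : ℝ) : ℂ) * Complex.I)) else 0) +
            (if k = -(fun i => (W.phase j).m i * n) then
              starRingEnd ℂ (Complex.exp ((W.phase j).φ * Complex.I)) *
                (-(1 / (2 * ((2 * Real.pi * ‖latticeVec (W.phase j).m‖ : ℝ) : ℂ) * Complex.I))) else 0)) •
            EuclideanSpace.complexify (W.phase j).e)) := by
  classical
  set B : Finset (Fin 3 → ℤ) := Finset.univ.biUnion fun j : Fin k₀ =>
    ({(fun i => (W.phase j).m i * n), -(fun i => (W.phase j).m i * n)} : Finset (Fin 3 → ℤ)) with hB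
  funext x
  rw [cell_eq_layerComb, Function.comp_apply, map_sum, Torus.trigPoly_apply]
  -- each summand: `complexify (c • layer) = c • trigPoly {±K_j} C_j x = c • trigPoly B C_j x`
  have hterm : ∀ j : Fin k₀, ∀ c : ℝ,
      EuclideanSpace.complexify (c • (W.phase j).layer (n • x)) =
        (c : ℂ) • ∑ k ∈ B, UnitAddTorus.mFourier k x •
          (((if k = (fun i => (W.phase j).m i * n) then
              Complex.exp ((W.phase j).φ * Complex.I) *
                (1 / (2 * ((2 * Real.pi * ‖latticeVec (W.phase j).m‖ : ℝ) : ℂ) * Complex.I)) else 0) +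
            (if k = -(fun i => (W.phase j).m i * n) then
              starRingEnd ℂ (Complex.exp ((W.phase j).φ * Complex.I)) *
                (-(1 / (2 * ((2 * Real.pi * ‖latticeVec (W.phase j).m‖ : ℝ) : ℂ) * Complex.I))) else 0)) •
            EuclideanSpace.complexify (W.phase j).e) := by
    intro j c
    rw [(EuclideanSpace.complexify (ι := Fin 3)).map_smul, ← Complex.coe_smul]
    congr 1
    have h1 := congrFun (complexify_layer_nsmul_eq_trigPoly (W.phase j) hn) x
    rw [Function.comp_apply] at h1
    rw [h1, ← Torus.trigPoly_apply]
    refine (congrFun (Torus.trigPoly_subset (S := ({(fun i => (W.phase j).m i * n), -(fun i => (W.phase j).m i * n)} :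
      Finset (Fin 3 → ℤ))) (S' := B) ?_ ?_) x).symm
    · intro k hk
      rw [hB, Finset.mem_biUnion]
      exact ⟨j, Finset.mem_univ _, hk⟩
    · intro k _ hk
      rw [Finset.mem_insert, Finset.mem_singleton, not_or] at hk
      rw [if_neg hk.1, if_neg hk.2, add_zero, zero_smul]
  simp_rw [hterm, Finset.smul_sum]
  rw [Finset.sum_comm]
  refine Finset.sum_congr rfl fun k _ => Finset.sum_congr rfl fun j _ => ?_
  rw [smul_comm]

/-- **The cell carrier of a lattice word is a trigonometric-polynomial carrier** (`Torus.TrigPolyCarrier`) with frequency set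
`⋃ⱼ {±K_j}` (`K_j i = m_j i * n`), its own Fourier coefficients as coefficient family, and the bound `k₀/(2π)`; every
frequency of the set is `± n • m_j` for some slot `j`. -/
theorem trigPolyCarrier_cell (W : LatticeWord k₀) {n : ℕ} (hn : 0 < n) :
    Torus.TrigPolyCarrier (W.cell n)
      (Finset.univ.biUnion fun j : Fin k₀ =>
        ({(fun i => (W.phase j).m i * n), -(fun i => (W.phase j).m i * n)} : Finset (Fin 3 → ℤ)))
      (fun t k => UnitAddTorus.mFourierCoeff (EuclideanSpace.complexify ∘ W.cell n t) k) (k₀ / (2 * Real.pi)) := by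
  classical
  set B : Finset (Fin 3 → ℤ) := Finset.univ.biUnion fun j : Fin k₀ =>
    ({(fun i => (W.phase j).m i * n), -(fun i => (W.phase j).m i * n)} : Finset (Fin 3 → ℤ)) with hB
  have hmemB : ∀ k, k ∈ B ↔ ∃ j : Fin k₀, k = (fun i => (W.phase j).m i * n) ∨ k = -(fun i => (W.phase j).m i * n) := by
    intro k
    simp only [hB, Finset.mem_biUnion, Finset.mem_univ, true_and, Finset.mem_insert, Finset.mem_singleton]
  -- Fourier coefficients of the slices
  have hcoef : ∀ t k, UnitAddTorus.mFourierCoeff (EuclideanSpace.complexify ∘ W.cell n t) k =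
      if k ∈ B then (∑ j : Fin k₀, (((1 / (n : ℝ)) *
          LatticeWord.trapezoid (W.start j) (W.phase j).τ W.ramp (Int.fract (t / W.period) * W.period) : ℝ) : ℂ) •
          (((if k = (fun i => (W.phase j).m i * n) then
              Complex.exp ((W.phase j).φ * Complex.I) *
                (1 / (2 * ((2 * Real.pi * ‖latticeVec (W.phase j).m‖ : ℝ) : ℂ) * Complex.I)) else 0) +
            (if k = -(fun i => (W.phase j).m i * n) then
              starRingEnd ℂ (Complex.exp ((W.phase j).φ * Complex.I)) *
                (-(1 / (2 * ((2 * Real.pi * ‖latticeVec (W.phase j).m‖ : ℝ) : ℂ) * Complex.I))) else 0)) •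
            EuclideanSpace.complexify (W.phase j).e)) else 0 := by
    intro t k
    rw [complexify_comp_cell_eq_trigPoly W hn t, Torus.mFourierCoeff_trigPoly]
  have hcont : Continuous (stLift (W.cell n)) := by
    have e : stLift (W.cell n) = uncurry (W.cell n) ∘ Prod.map id proj := by
      funext ⟨t, y⟩
      rfl
    rw [e]
    exact (continuous_uncurry_cell W n).comp (continuous_id.prodMap continuous_proj)
  refine ⟨?_, ?_, ?_, ?_, ?_, ?_, ?_⟩
  · -- symm
    intro k hk
    obtain ⟨j, hj | hj⟩ := (hmemB k).1 hk
    · exact (hmemB _).2 ⟨j, Or.inr (by rw [hj])⟩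
    · exact (hmemB _).2 ⟨j, Or.inl (by rw [hj, neg_neg])⟩
  · -- eq
    intro t
    funext x
    have h1 := congrFun (complexify_comp_cell_eq_trigPoly W hn t) x
    rw [Function.comp_apply] at h1
    rw [Torus.realTrigPoly_apply, ← EuclideanSpace.realPart_complexify (W.cell n t x), h1]
    congr 1
    refine congrFun (Torus.trigPoly_congr fun k hk => ?_) x
    rw [hcoef t k, if_pos hk]
  · -- support
    intro t k hk
    rw [hcoef t k, if_neg hk]
  · -- conjSymm
    intro t
    exact isConjSymm_mFourierCoeff ((isSmooth_cell W n t).continuous.integrable_unitAddTorus)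
  · -- transversal
    intro t k
    exact (isDivFree_cell W n t).sum_mul_mFourierCoeff_eq_zero (isSmooth_cell W n t) k
  · -- norm_le
    intro t k
    exact norm_mFourierCoeff_le_of_forall_norm_le (fun x => by
      rw [Function.comp_apply, (EuclideanSpace.complexify (ι := Fin 3)).norm_map]
      exact norm_cell_le W n t x) k
  · -- continuous
    intro k
    rw [← continuousOn_univ]
    exact continuousOn_mFourierCoeff_of_continuousOn_stLift (S := univ) hcont.continuousOn k

/-! ### The registered stub -/

/-- **Registered stub `stub_sectorExists` of crux K2R `RealisedQuasiStaticCellLaw` (line `floquet-bloch`, skeleton r15)**: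
for ANY lattice word `W'`, cell number `n ≥ 1`, viscosity `κ > 0`, Bloch sector `{k ≡ ±ℓ (mod n)}` and `R` with `R² ≤ |k|²`
on the non-zero frequencies of the sector, every `H¹` weakly divergence-free mean-zero datum Fourier-supported in the sector
admits a weak `A = 0` solution around `W'.cell n` on `(0,T)` staying in the sector for a.e. `t` and obeying the sector-Poincaré
decay `∫‖w t‖² ≤ e^{-8π²κR²t} ∫‖w₀‖²` for a.e. `t` — the Fourier–Galerkin solution of `Torus.PVSetup.exists_weak_solution`
for the trigonometric-polynomial carrier `W'.cell n` (`trigPolyCarrier_cell`) and the sector `±ℓ + nℤ³`, which is stable under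
the carrier frequencies `± n m_j`. [cite: RobinsonRodrigoSadowski2016, Thm. 4.4] -/
theorem stub_sectorExists : ∀ (k₀ : ℕ) (W' : LatticeWord k₀) (n : ℕ), 0 < n → ∀ κ > (0:ℝ), ∀ ℓ : Fin 3 → ℤ, ∀ R : ℝ,
    (∀ k : Fin 3 → ℤ, ((∃ z : Fin 3 → ℤ, k = ℓ + (n:ℤ) • z) ∨ (∃ z : Fin 3 → ℤ, k = -ℓ + (n:ℤ) • z)) → k ≠ 0 →
      R ^ 2 ≤ FunctionSpaces.Torus.freqNormSq k) →
    ∀ w₀ : UnitAddTorus (Fin 3) → EuclideanSpace ℝ (Fin 3),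
      FunctionSpaces.Torus.MemSobolev 1 (FunctionSpaces.EuclideanSpace.complexify ∘ w₀) →
      FunctionSpaces.Torus.IsWeaklyDivFree w₀ → FunctionSpaces.Torus.HasZeroMean w₀ →
      (∀ k : Fin 3 → ℤ, ¬ ((∃ z : Fin 3 → ℤ, k = ℓ + (n:ℤ) • z) ∨ (∃ z : Fin 3 → ℤ, k = -ℓ + (n:ℤ) • z)) →
        UnitAddTorus.mFourierCoeff (FunctionSpaces.EuclideanSpace.complexify ∘ w₀) k = 0) → ∀ T > (0:ℝ),
      ∃ w, Torus.IsWeakPassiveVectorOn 0 T κ (W'.cell n) w₀ w ∧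
        (∀ᵐ t ∂(volume.restrict (Ioo 0 T)), ∀ k : Fin 3 → ℤ,
          ¬ ((∃ z : Fin 3 → ℤ, k = ℓ + (n:ℤ) • z) ∨ (∃ z : Fin 3 → ℤ, k = -ℓ + (n:ℤ) • z)) →
          UnitAddTorus.mFourierCoeff (FunctionSpaces.EuclideanSpace.complexify ∘ w t) k = 0) ∧
        ∀ᵐ t ∂(volume.restrict (Ioo 0 T)),
          ∫ x, ‖w t x‖ ^ 2 ≤ Real.exp (-(8 * Real.pi ^ 2 * κ * R ^ 2) * t) * ∫ x, ‖w₀ x‖ ^ 2 := by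
  classical
  intro k₀ W' n hn κ hκ ℓ R hR w₀ hw₀ hdiv hmean hsupp T hT
  set Sec : Set (Fin 3 → ℤ) := {k | (∃ z : Fin 3 → ℤ, k = ℓ + (n:ℤ) • z) ∨ (∃ z : Fin 3 → ℤ, k = -ℓ + (n:ℤ) • z)}
    with hSec
  have hcar := trigPolyCarrier_cell W' hn
  -- the Bloch sector is stable under the carrier frequencies `± n • m_j`
  have hsector : ∀ k l : Fin 3 → ℤ, l ∈ (Finset.univ.biUnion fun j : Fin k₀ =>
      ({(fun i => (W'.phase j).m i * n), -(fun i => (W'.phase j).m i * n)} : Finset (Fin 3 → ℤ))) →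
      k - l ∈ Sec → k ∈ Sec := by
    intro k l hl hkl
    simp only [Finset.mem_biUnion, Finset.mem_univ, true_and, Finset.mem_insert, Finset.mem_singleton] at hl
    obtain ⟨j, hj⟩ := hl
    have hl' : ∃ μ : Fin 3 → ℤ, l = (n:ℤ) • μ := by
      rcases hj with hj | hj
      · exact ⟨(W'.phase j).m, by rw [hj]; funext i; simp [mul_comm]⟩
      · exact ⟨-(W'.phase j).m, by rw [hj]; funext i; simp [mul_comm]⟩
    obtain ⟨μ, rfl⟩ := hl'
    have ek : k = (k - (n:ℤ) • μ) + (n:ℤ) • μ := (sub_add_cancel k _).symm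
    rcases hkl with ⟨z, hz⟩ | ⟨z, hz⟩
    · left
      exact ⟨z + μ, by rw [ek, hz, smul_add]; abel⟩
    · right
      exact ⟨z + μ, by rw [ek, hz, smul_add]; abel⟩
  have hmemLp : MemLp w₀ 2 volume := memLp_two_of_memSobolev_one_complexify hw₀
  have hzero : UnitAddTorus.mFourierCoeff (FunctionSpaces.EuclideanSpace.complexify ∘ w₀) 0 = 0 := by
    rw [mFourierCoeff_complexify_zero_eq_mean (hmemLp.integrable one_le_two)]
    have h0 : ∫ x, w₀ x = 0 := hmean
    rw [h0, map_zero]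
  have hPV : Torus.PVSetup κ (W'.cell n) _ _ _ Sec w₀ :=
    ⟨hκ.le, hcar, hsector, hmemLp, hdiv, hzero, fun k hk => hsupp k hk⟩
  obtain ⟨w, hweak, -, hsup, hdec⟩ := hPV.exists_weak_solution
  refine ⟨w, hweak T hT, ?_, ?_⟩
  · filter_upwards [ae_restrict_mem measurableSet_Ioo] with t ht
    intro k hk
    exact hsup t ht.1.le k (Or.inl hk)
  · filter_upwards [ae_restrict_mem measurableSet_Ioo] with t ht
    exact hdec R (fun k hk hk0 => hR k hk hk0) t ht.1.le

end Summit.AnomalousDissipation.AnomalousDissipation.Theorems.SolenoidalFractalHomogenisation.RealisedQuasiStaticCellLaw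

end
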